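import Mathlib.MeasureTheory.Function.L2Space
import Mathlib.MeasureTheory.Function.StronglyMeasurable.Inner
import Mathlib.Analysis.Calculus.Deriv.Prod
import Literature.Analysis.FunctionSpaces.TorusPeriodization
import Literature.Analysis.FluidPDE.WeakSolution
import HarnessLib

/-!
# Torus-to-space bridge for forced weak Navier–Stokes solutions

Analysis/FluidPDE proofs file for `Literature.Analysis.FluidPDE.WeakSolution`, which recorded as
the named fact `Torus.IsWeakNSSolutionForcedOn.lift` (retired there in the 2026-08-15 verdict
clean-up; kept at the end of this file as a deprecated alias of the corrected statement
`Torus.IsWeakNSSolutionForcedOn.lift_of_integrable`) that a forced weak (pressure-free) solution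
with datum on the flat torus `T^d × [0, T)` (`Torus.IsWeakNSSolutionForcedOn T ν f u₀ u`) lifts
to a `ℤ^d`-periodic weak solution on `ℝ^d × [0, T)` in the sense of the `E`-side predicate
`IsWeakNSSolutionOn` (Fefferman's periodic problems (8), (10)–(11) are posed on `ℝⁿ`; the weak
formulation is Leray's, 1934, §31, relation (5.15)).

## The corrected statement

The vendored fact quantifies over *arbitrary* forces `f` and data `u₀`: the torus predicate
`Torus.IsWeakNSSolutionForcedOn` carries no measurability or integrability of `f` and `u₀`, which
enter only through the pairings `∫ ⟪f t, ψ t⟫`, `∫ ⟪u₀, ψ 0⟫` inside the weak identity — Bochner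
integrals, equal to the junk value `0` when the pairing is not integrable. Every source assumes
integrable data (Leray 1934: `f = 0`, `u₀ ∈ L²`; Temam, Ch. III §1.1: `f ∈ L²(0,T; V')`,
`u₀ ∈ H`; Buckmaster–Vicol 2019, Def. 1.1: `f = 0`). The bridge is proved by pairing a compactly
supported test field `ψ` on `(-∞, T) × ℝ^d` with the lift exactly as its periodisation
`Ψ = ∑_{k ∈ ℤ^d} ψ(·, · + k)` is paired on `T^d`, i.e. by the unfolding identity
`∫_{ℝ^d} g = ∫_{T^d} ∑ₖ g(· + k)` (Stein–Weiss, Ch. VII §2, Thm. 2.4), which requires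
`g ∈ L¹(ℝ^d)`; for the `u`-terms this holds for a.e. `t` (`u ∈ L²ₜL²ₓ`), for the force and datum
terms it needs `f t ∈ L¹(T^d)` (a.e. `t`) and `u₀ ∈ L¹(T^d)`. Without these the two sides'
junk values need not match a priori (finite additivity fails for non-integrable Bochner
integrands, so a decomposition of `ψ` into small-support pieces does not help either), and the
fact as vendored is not derivable *by this unfolding argument*; whether it nevertheless holds as
stated (by some junk-robust argument) is open — no counterexample is known, and no source states
the bridge for non-integrable data. This file therefore vendors the corrected statement
`Torus.IsWeakNSSolutionForcedOn.lift_of_integrable` — the same conclusion under the sources'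
standing hypotheses `∀ᵐ t ∈ (0,T), f t ∈ L¹(T^d)` and `u₀ ∈ L¹(T^d)` — and proves it
(`Torus.IsWeakNSSolutionForcedOn.lift_of_integrable_holds`). The original `lift` was retired from
`WeakSolution.lean` (2026-08-15; it had no users) and the name `Torus.IsWeakNSSolutionForcedOn.lift`
now resolves, deprecated, to `lift_of_integrable`.

## Proof

* measurability: `uncurry (fun t ↦ lift (u t)) = stLift u` definitionally;
* local square integrability on `(0,T) × K`: Tonelli's inequality (`lintegral_prod_le`) and the
  covering bound `∫_K H ∘ proj ≤ #window · ∫_{T^d} H` (`Torus.setLIntegral_lift_le`);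
* weak divergence-freeness of `lift (u t)` from that of `u t`: if `⟪lift (u t), ∇θ⟫` is not
  integrable the integral is `0` by convention; otherwise unfold and use
  `∇(periodize θ) = periodize ∇θ` (`Torus.gradient_periodize'`);
* the weak identity: `Ψ t = periodize (ψ t)` is a torus space–time test field (jointly smooth,
  `Torus.contDiff_uncurry_perSum`; vanishing for `t ≥ T' `, some `T' < T`, by compactness of the
  support in `(-∞, T) × ℝ^d`), divergence free (`D(periodize ψ) = ∑ₖ Dψ(· + k)` and linearity
  of the trace); the torus weak integrand for `Ψ` at `x` is the lattice sum of the `ℝ^d` weak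
  integrand for `ψ` over the fibre of `x` (`perSum_weakIntegrand_repr`, a finite window sum);
  for a.e. `t` the latter is integrable, so the space integrals agree, and so do the time
  integrals (`integral_congr_ae`); likewise the datum term.

## References

* J. Leray, *Sur le mouvement d'un liquide visqueux emplissant l'espace*, Acta Math. 63 (1934),
  §31, relation (5.15), pp. 240–241 (turbulent = weak solutions; `u₀ ∈ L²`, no force).
* C. L. Fefferman, *Existence and smoothness of the Navier–Stokes equation* (Clay, 2000/2006),
  (8), (10)–(11) (the periodic problem posed on `ℝⁿ`).
* E. M. Stein, G. Weiss, *Introduction to Fourier Analysis on Euclidean Spaces* (1971), Ch. VII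
  §2, (2.1) and Thm. 2.4 (periodisation and unfolding of integrals).
* R. Temam, *Navier–Stokes Equations* (3rd ed., 1984), Ch. III §1.1 (data `f ∈ L²(0,T;V')`,
  `u₀ ∈ H`).
-/

noncomputable section

open MeasureTheory TopologicalSpace Set Function Filter Metric
open scoped Laplacian InnerProductSpace RealInnerProductSpace ENNReal Topology

namespace Literature.Analysis.FluidPDE

open Literature.Analysis.FunctionSpaces

variable {d : Type*} [Fintype d] [DecidableEq d]

/-! ### Auxiliary integrability and continuity lemmas on a finite-dimensional space -/

section Aux

variable {E' : Type*} [NormedAddCommGroup E'] [InnerProductSpace ℝ E'] [FiniteDimensional ℝ E']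
  [MeasurableSpace E'] [BorelSpace E']
variable {F' : Type*} [NormedAddCommGroup F'] [InnerProductSpace ℝ F']

omit [MeasurableSpace E'] [BorelSpace E'] in
/-- The Laplacian of a `C²` field is continuous (it is a finite sum of second derivatives along
an orthonormal basis, Mathlib `laplacian_eq_iteratedFDeriv_stdOrthonormalBasis`). Twin of
`FluidPDE.continuous_laplacian` (`WholeSpaceIBP`, not imported here to keep the import graph of
this bridge light). [folklore] -/
theorem continuous_laplacian_of_contDiff_two {v : E' → F'} (hv : ContDiff ℝ 2 v) :
    Continuous (Δ v) := by
  rw [InnerProductSpace.laplacian_eq_iteratedFDeriv_stdOrthonormalBasis]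
  exact continuous_finsetSum _ fun i _ =>
    (ContinuousMultilinearMap.apply ℝ (fun _ : Fin 2 => E') F' _).continuous.comp
      (hv.continuous_iteratedFDeriv le_rfl)

/-- A locally integrable field pairs integrably with a continuous field supported in a ball:
`|⟪V, φ⟫| ≤ ‖φ‖_∞ ‖V‖` on the ball, `0` outside. [folklore] -/
theorem integrable_inner_of_support_subset_closedBall {V φ : E' → F'}
    (hV : LocallyIntegrable V volume) (hφ : Continuous φ) {R : ℝ}
    (hR : support φ ⊆ closedBall 0 R) : Integrable (fun y => ⟪V y, φ y⟫) volume := by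
  have hK : IsCompact (closedBall (0 : E') R) := isCompact_closedBall 0 R
  have hφc : HasCompactSupport φ :=
    HasCompactSupport.intro hK fun x hx => notMem_support.1 fun h => hx (hR h)
  obtain ⟨C, hC⟩ := hφ.bounded_above_of_compact_support hφc
  have hsupp : support (fun y => ⟪V y, φ y⟫) ⊆ closedBall 0 R :=
    fun y hy => hR fun h => hy (by simp [h])
  rw [← integrableOn_iff_integrable_of_support_subset hsupp]
  have hVK : IntegrableOn V (closedBall 0 R) volume := hV.integrableOn_isCompact hK
  refine Integrable.mono' (hVK.norm.mul_const C)
    (hVK.aestronglyMeasurable.inner hφ.aestronglyMeasurable) (ae_of_all _ fun y => ?_)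
  calc ‖⟪V y, φ y⟫‖ ≤ ‖V y‖ * ‖φ y‖ := norm_inner_le_norm _ _
    _ ≤ ‖V y‖ * C := by gcongr; exact hC y

/-- The quadratic pairing `⟪V, L V⟫` of a locally square-integrable field through a continuous
operator field supported in a ball is integrable: `|⟪V, L V⟫| ≤ ‖L‖_∞ ‖V‖²`. [folklore] -/
theorem integrable_inner_clm_apply_of_support_subset_closedBall {V : E' → F'}
    {L : E' → F' →L[ℝ] F'} (hV2 : LocallyIntegrable (fun y => ‖V y‖ ^ 2) volume)
    (hVm : AEStronglyMeasurable V volume) (hL : Continuous L) {R : ℝ}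
    (hR : support L ⊆ closedBall 0 R) : Integrable (fun y => ⟪V y, L y (V y)⟫) volume := by
  have hK : IsCompact (closedBall (0 : E') R) := isCompact_closedBall 0 R
  have hLc : HasCompactSupport L :=
    HasCompactSupport.intro hK fun x hx => notMem_support.1 fun h => hx (hR h)
  obtain ⟨C, hC⟩ := hL.bounded_above_of_compact_support hLc
  have hsupp : support (fun y => ⟪V y, L y (V y)⟫) ⊆ closedBall 0 R :=
    fun y hy => hR fun h => hy (by simp [h])
  rw [← integrableOn_iff_integrable_of_support_subset hsupp]
  have h2K : IntegrableOn (fun y => ‖V y‖ ^ 2) (closedBall 0 R) volume :=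
    hV2.integrableOn_isCompact hK
  have hmeas : AEStronglyMeasurable (fun y => ⟪V y, L y (V y)⟫)
      (volume.restrict (closedBall 0 R)) :=
    hVm.restrict.inner (isBoundedBilinearMap_apply.continuous.comp_aestronglyMeasurable
      (hL.aestronglyMeasurable.prodMk hVm.restrict))
  refine Integrable.mono' (h2K.const_mul C) hmeas (ae_of_all _ fun y => ?_)
  calc ‖⟪V y, L y (V y)⟫‖ ≤ ‖V y‖ * ‖L y (V y)‖ := norm_inner_le_norm _ _
    _ ≤ ‖V y‖ * (C * ‖V y‖) := by
        gcongr
        exact (ContinuousLinearMap.le_opNorm _ _).trans (by gcongr; exact hC y)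
    _ = C * ‖V y‖ ^ 2 := by ring

end Aux

/-! ### Space–time test fields on `(-∞, T) × X`: time support and time derivative -/

section TestFields

variable {X : Type*} [NormedAddCommGroup X] [NormedSpace ℝ X]
variable {F : Type*} [NormedAddCommGroup F] [NormedSpace ℝ F]
variable {T : ℝ} {ψ : ℝ → X → F}

/-- A space–time test field on the slab `(-∞, T) × X` vanishes identically in space for all
times `t ≥ T'`, for some `T' < T`: the time projection of its (compact) support is a compact
subset of `(-∞, T)`. [folklore] -/
theorem IsSpaceTimeTestOn.exists_lt_forall_slice_eq_zero
    (hψ : IsSpaceTimeTestOn (slab X (Iio T) isOpen_Iio) ψ) :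
    ∃ T' < T, ∀ t, T' ≤ t → ψ t = 0 := by
  set S : Set ℝ := Prod.fst '' tsupport (uncurry ψ) with hS
  have hSc : IsCompact S := hψ.hasCompactSupport.image continuous_fst
  have hST : S ⊆ Iio T := by
    rintro _ ⟨z, hz, rfl⟩
    exact mem_slab.1 (SetLike.mem_coe.1 (hψ.tsupport_subset hz))
  have hzero : ∀ t, t ∉ S → ψ t = 0 := fun t ht => funext fun y =>
    image_eq_zero_of_notMem_tsupport (f := uncurry ψ) (x := (t, y)) fun h => ht ⟨(t, y), h, rfl⟩
  by_cases hne : S.Nonempty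
  · have hmem : sSup S ∈ S := hSc.sSup_mem hne
    have h2 : sSup S < T := hST hmem
    refine ⟨(sSup S + T) / 2, by linarith, fun t ht => hzero t fun htS => ?_⟩
    have h1 : t ≤ sSup S := le_csSup hSc.bddAbove htS
    linarith
  · exact ⟨T - 1, by linarith, fun t _ => hzero t fun htS => hne ⟨t, htS⟩⟩

/-- The time derivative of a space–time test field is the space–time derivative in the direction
`(1, 0)`: `∂ₜψ(t, x) = D(uncurry ψ)(t, x)(1, 0)`. [folklore] -/
theorem IsSpaceTimeTestOn.timeDeriv_eq_fderiv {Q : Opens (ℝ × X)} (hψ : IsSpaceTimeTestOn Q ψ)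
    (t : ℝ) (x : X) : timeDeriv ψ t x = fderiv ℝ (uncurry ψ) (t, x) ((1 : ℝ), (0 : X)) := by
  have hd : DifferentiableAt ℝ (uncurry ψ) (t, x) :=
    (hψ.contDiff.differentiable (by simp)).differentiableAt
  exact (hd.hasFDerivAt.comp_hasDerivAt t ((hasDerivAt_id t).prodMk (hasDerivAt_const t x))).deriv

/-- The time slices `∂ₜψ(t, ·)` of the time derivative of a space–time test field are
continuous. [folklore] -/
theorem IsSpaceTimeTestOn.continuous_timeDeriv_slice {Q : Opens (ℝ × X)}
    (hψ : IsSpaceTimeTestOn Q ψ) (t : ℝ) : Continuous (timeDeriv ψ t) := by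
  have heq : timeDeriv ψ t = fun x => fderiv ℝ (uncurry ψ) (t, x) ((1 : ℝ), (0 : X)) :=
    funext (hψ.timeDeriv_eq_fderiv t)
  rw [heq]
  exact ((hψ.contDiff.continuous_fderiv (by simp)).comp (Continuous.prodMk_right t)).clm_apply
    continuous_const

end TestFields

/-! ### Periodisation of space–time test fields on `(-∞, T) × ℝ^d` -/

section Periodize

variable {F : Type*} [NormedAddCommGroup F] [NormedSpace ℝ F]
variable {T : ℝ}

/-- **The periodisation of a space–time test field is a torus space–time test field.** For a
test field `ψ` on `(-∞, T) × ℝ^d`, `t ↦ periodize (ψ t)` has a `C^∞` space–time lift (the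
space-periodised field `(t, y) ↦ ∑ₖ ψ t (y + k)`, `Torus.contDiff_uncurry_perSum`) and vanishes
for `t ≥ T'`, some `T' < T` (Grafakos, §3.1.1: periodisation maps `C_c^∞(ℝⁿ)` to `C^∞(Tⁿ)`).
[folklore] -/
theorem IsSpaceTimeTestOn.isSpaceTimeTest_periodize {ψ : ℝ → EuclideanSpace ℝ d → F}
    (hψ : IsSpaceTimeTestOn (slab (EuclideanSpace ℝ d) (Iio T) isOpen_Iio) ψ) :
    Torus.IsSpaceTimeTest T (fun t => Torus.periodize (ψ t)) := by
  obtain ⟨R, hR⟩ := Torus.exists_forall_tsupport_subset_closedBall hψ.hasCompactSupport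
  obtain ⟨T', hT'T, hT'⟩ := hψ.exists_lt_forall_slice_eq_zero
  refine ⟨?_, T', hT'T, fun t ht => ?_⟩
  · rw [Torus.stLift_periodize]
    exact Torus.contDiff_uncurry_perSum hψ.contDiff hR
  · show Torus.periodize (ψ t) = 0
    rw [hT' t ht, Torus.periodize_zero]

/-- **The periodisation of a divergence-free test field is divergence free**:
`div (periodize ψ)(x) = tr ∑ₖ Dψ(y + k) = ∑ₖ div ψ (y + k) = 0` (`y = repr x`;
`Torus.fderiv_periodize'`, linearity of the trace). [folklore] -/
theorem IsSpaceTimeTestOn.isDivFreeTest_periodize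
    {ψ : ℝ → EuclideanSpace ℝ d → EuclideanSpace ℝ d}
    (hψ : IsSpaceTimeTestOn (slab (EuclideanSpace ℝ d) (Iio T) isOpen_Iio) ψ)
    (hdiv : ∀ t, VectorCalculus.IsDivFree (ψ t)) :
    Torus.IsDivFreeTest (fun t => Torus.periodize (ψ t)) := by
  obtain ⟨R, hR⟩ := Torus.exists_forall_tsupport_subset_closedBall hψ.hasCompactSupport
  obtain ⟨n, hn⟩ := exists_nat_ge (R + Fintype.card d)
  intro t x
  have h1 : ContDiff ℝ 1 (ψ t) := (hψ.contDiff_slice t).of_le (by exact_mod_cast le_top)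
  have hper : Torus.IsContDiff 1 (Torus.periodize (ψ t)) := Torus.isContDiff_periodize h1 (hR t)
  show Torus.divergence (Torus.periodize (ψ t)) x = 0
  rw [Torus.divergence_eq_trace_fderiv hper, Torus.fderiv_periodize' h1 (hR t),
    Torus.perSum_eq_sum_of_mem_unitCube ((support_fderiv_subset ℝ).trans (hR t))
      (Torus.repr_mem_unitCube x) hn,
    ContinuousLinearMap.toLinearMap_sum, map_sum]
  exact Finset.sum_eq_zero fun k _ => hdiv t _

/-- For a boundedly supported `φ` on `ℝ^d` and any `h` on `T^d`, the periodisation of the pairing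
`⟪h ∘ proj, φ⟫` is the pairing of `h ∘ proj` with the periodisation of `φ`:
`∑ₖ ⟪h(proj(y + k)), φ(y + k)⟫ = ⟪h(proj y), ∑ₖ φ(y + k)⟫` (a finite sum; twin of
`Torus.perSum_smul_lift` for the inner product). [folklore] -/
theorem Torus.perSum_inner_lift {G : Type*} [NormedAddCommGroup G] [InnerProductSpace ℝ G]
    {φ : EuclideanSpace ℝ d → G} {R : ℝ} (hφ : support φ ⊆ closedBall 0 R)
    (h : UnitAddTorus d → G) (y : EuclideanSpace ℝ d) :
    Torus.perSum (fun z => ⟪Torus.lift h z, φ z⟫) y = ⟪Torus.lift h y, Torus.perSum φ y⟫ := by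
  obtain ⟨n, hn⟩ := exists_nat_ge (R + ‖y‖)
  have hs : support (fun z => ⟪Torus.lift h z, φ z⟫) ⊆ closedBall 0 R :=
    fun z hz => hφ fun h0 => hz (by simp [h0])
  rw [Torus.perSum_eq_sum hs le_rfl hn, Torus.perSum_eq_sum hφ le_rfl hn, inner_sum]
  refine Finset.sum_congr rfl fun k _ => ?_
  rw [Torus.lift_apply, Torus.lift_apply, Torus.proj_add_latticeVec]

end Periodize

/-! ### The weak integrands on `ℝ^d` and on `T^d` -/

section Integrand

variable {T ν : ℝ} {ψ : ℝ → EuclideanSpace ℝ d → EuclideanSpace ℝ d}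

omit [DecidableEq d] in
/-- The `ℝ^d` weak integrand `⟪V, ∂ₜψ⟫ + ⟪V, (V·∇)ψ⟫ + ν⟪V, Δψ⟫ + ⟪G, ψ⟫` built from a test
field `ψ` supported (uniformly in time) in the closed ball of radius `R` is supported in that
ball. [folklore] -/
theorem support_weakIntegrand_subset {R : ℝ} (hR : ∀ t, tsupport (ψ t) ⊆ closedBall 0 R)
    (V G : EuclideanSpace ℝ d → EuclideanSpace ℝ d) (t : ℝ) :
    support (fun y => ⟪V y, timeDeriv ψ t y⟫ + ⟪V y, convect V (ψ t) y⟫ + ν * ⟪V y, Δ (ψ t) y⟫ +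
      ⟪G y, ψ t y⟫) ⊆ closedBall 0 R := by
  intro y hy
  by_contra hyR
  have h1 : deriv (fun s => ψ s y) t = 0 :=
    notMem_support.1 fun h => hyR (Torus.support_deriv_slice_subset hR t h)
  have h2 : fderiv ℝ (ψ t) y = 0 :=
    notMem_support.1 fun h => hyR ((support_fderiv_subset ℝ).trans (hR t) h)
  have h3 : Δ (ψ t) y = 0 :=
    notMem_support.1 fun h => hyR ((Torus.support_laplacian_subset (ψ t)).trans (hR t) h)
  have h4 : ψ t y = 0 := notMem_support.1 fun h => hyR ((subset_tsupport (ψ t)).trans (hR t) h)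
  exact hy (by simp [timeDeriv, convect, h1, h2, h3, h4])

/-- **Integrability of the `ℝ^d` weak integrand of a lifted slice.** For `v ∈ L²(T^d)`,
`g ∈ L¹(T^d)` and a test field `ψ` on `(-∞, T) × ℝ^d`, the integrand
`⟪lift v, ∂ₜψ(t)⟫ + ⟪lift v, (lift v·∇)ψ(t)⟫ + ν⟪lift v, Δψ(t)⟫ + ⟪lift g, ψ(t)⟫` is integrable
on `ℝ^d`: the lifts are locally integrable (`Torus.locallyIntegrable_lift`, also for `‖v‖²`) and
are paired with continuous fields supported in a fixed ball. [folklore] -/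
theorem integrable_weakIntegrand_lift
    (hψ : IsSpaceTimeTestOn (slab (EuclideanSpace ℝ d) (Iio T) isOpen_Iio) ψ)
    {v g : UnitAddTorus d → EuclideanSpace ℝ d} (hv : MemLp v 2 volume)
    (hg : Integrable g volume) (t : ℝ) :
    Integrable (fun y => ⟪Torus.lift v y, timeDeriv ψ t y⟫ +
      ⟪Torus.lift v y, convect (Torus.lift v) (ψ t) y⟫ + ν * ⟪Torus.lift v y, Δ (ψ t) y⟫ +
      ⟪Torus.lift g y, ψ t y⟫) volume := by
  obtain ⟨R, hR⟩ := Torus.exists_forall_tsupport_subset_closedBall hψ.hasCompactSupport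
  have hvi : Integrable v volume := hv.integrable one_le_two
  have hv2 : Integrable (fun x => ‖v x‖ ^ 2) volume := (memLp_two_iff_integrable_sq_norm hv.1).1 hv
  have hV : LocallyIntegrable (Torus.lift v) volume := Torus.locallyIntegrable_lift hvi
  have hV2 : LocallyIntegrable (fun y => ‖Torus.lift v y‖ ^ 2) volume :=
    Torus.locallyIntegrable_lift (H := fun x => ‖v x‖ ^ 2) hv2
  have hG : LocallyIntegrable (Torus.lift g) volume := Torus.locallyIntegrable_lift hg
  have hψt := hψ.contDiff_slice t
  have h2t : ContDiff ℝ 2 (ψ t) := hψt.of_le (by norm_cast)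
  refine (((integrable_inner_of_support_subset_closedBall hV (hψ.continuous_timeDeriv_slice t)
    (Torus.support_deriv_slice_subset hR t)).add
    (integrable_inner_clm_apply_of_support_subset_closedBall hV2 hV.aestronglyMeasurable
      (hψt.continuous_fderiv (by simp)) ((support_fderiv_subset ℝ).trans (hR t)))).add
    ((integrable_inner_of_support_subset_closedBall hV (continuous_laplacian_of_contDiff_two h2t)
      ((Torus.support_laplacian_subset (ψ t)).trans (hR t))).const_mul ν)).add
    (integrable_inner_of_support_subset_closedBall hG hψt.continuous
      ((subset_tsupport _).trans (hR t)))

/-- **The torus weak integrand for the periodised test field is the lattice sum of the `ℝ^d`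
weak integrand.** For `Ψ t = periodize (ψ t)` and `x = proj y`, `y = repr x`,
`∑ₖ (⟪u(proj ·), ∂ₜψ⟫ + ⟪u(proj ·), (u(proj ·)·∇)ψ⟫ + ν⟪u(proj ·), Δψ⟫ + ⟪f(proj ·), ψ⟫)(y + k)
 = ⟪u x, ∂ₜΨ x⟫ + ⟪u x, (u·∇)Ψ x⟫ + ν⟪u x, ΔΨ x⟫ + ⟪f x, Ψ x⟫`, since `proj (y + k) = x` and
`∂ₜ`, `D`, `Δ` commute with periodisation (`Torus.timeDeriv_periodize`,
`Torus.fderiv_periodize'`, `Torus.laplacian_periodize'`); all sums are finite. [folklore] -/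
theorem perSum_weakIntegrand_repr {u f : ℝ → UnitAddTorus d → EuclideanSpace ℝ d}
    (hψ : IsSpaceTimeTestOn (slab (EuclideanSpace ℝ d) (Iio T) isOpen_Iio) ψ) {R : ℝ}
    (hR : ∀ t, tsupport (ψ t) ⊆ closedBall 0 R) (t : ℝ) (x : UnitAddTorus d) :
    Torus.perSum (fun y => ⟪Torus.lift (u t) y, timeDeriv ψ t y⟫ +
        ⟪Torus.lift (u t) y, convect (Torus.lift (u t)) (ψ t) y⟫ +
        ν * ⟪Torus.lift (u t) y, Δ (ψ t) y⟫ + ⟪Torus.lift (f t) y, ψ t y⟫) (Torus.repr x) =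
      ⟪u t x, Torus.timeDeriv (fun s => Torus.periodize (ψ s)) t x⟫ +
        ⟪u t x, Torus.convect (u t) (Torus.periodize (ψ t)) x⟫ +
        ν * ⟪u t x, Torus.laplacian (Torus.periodize (ψ t)) x⟫ +
        ⟪f t x, Torus.periodize (ψ t) x⟫ := by
  obtain ⟨n, hn⟩ := exists_nat_ge (R + Fintype.card d)
  have hy := Torus.repr_mem_unitCube x
  have h1 : ContDiff ℝ 1 (uncurry ψ) := hψ.contDiff.of_le (by exact_mod_cast le_top)
  have h1t : ContDiff ℝ 1 (ψ t) := (hψ.contDiff_slice t).of_le (by exact_mod_cast le_top)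
  have h2t : ContDiff ℝ 2 (ψ t) := (hψ.contDiff_slice t).of_le (by norm_cast)
  have hsd : support (fun y => deriv (fun s => ψ s y) t) ⊆ closedBall 0 R :=
    Torus.support_deriv_slice_subset hR t
  have hsD : support (fun y => fderiv ℝ (ψ t) y) ⊆ closedBall 0 R :=
    (support_fderiv_subset ℝ).trans (hR t)
  have hsL : support (fun y => Δ (ψ t) y) ⊆ closedBall 0 R :=
    (Torus.support_laplacian_subset (ψ t)).trans (hR t)
  have hs0 : support (ψ t) ⊆ closedBall 0 R := (subset_tsupport _).trans (hR t)
  have eT : Torus.timeDeriv (fun s => Torus.periodize (ψ s)) t x =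
      ∑ k ∈ Torus.latticeWindow d n, deriv (fun s => ψ s (Torus.repr x + Torus.latticeVec k)) t := by
    rw [Torus.timeDeriv_periodize h1 hR t x, Torus.periodize_apply,
      Torus.perSum_eq_sum_of_mem_unitCube hsd hy hn]
  have eD : Torus.fderiv (Torus.periodize (ψ t)) x =
      ∑ k ∈ Torus.latticeWindow d n, fderiv ℝ (ψ t) (Torus.repr x + Torus.latticeVec k) := by
    rw [Torus.fderiv_periodize' h1t (hR t), Torus.perSum_eq_sum_of_mem_unitCube hsD hy hn]
  have eL : Torus.laplacian (Torus.periodize (ψ t)) x =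
      ∑ k ∈ Torus.latticeWindow d n, Δ (ψ t) (Torus.repr x + Torus.latticeVec k) := by
    rw [Torus.laplacian_periodize' h2t (hR t), Torus.perSum_eq_sum_of_mem_unitCube hsL hy hn]
  have e0 : Torus.periodize (ψ t) x =
      ∑ k ∈ Torus.latticeWindow d n, ψ t (Torus.repr x + Torus.latticeVec k) := by
    rw [Torus.periodize_apply, Torus.perSum_eq_sum_of_mem_unitCube hs0 hy hn]
  rw [Torus.perSum_eq_sum_of_mem_unitCube
      (support_weakIntegrand_subset hR (Torus.lift (u t)) (Torus.lift (f t)) t) hy hn,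
    Torus.convect, eT, eD, eL, e0]
  simp only [Finset.sum_add_distrib, inner_sum, _root_.sum_apply, Finset.mul_sum,
    Torus.lift_apply, Torus.proj_add_latticeVec, Torus.proj_repr, timeDeriv_apply, convect_apply]

end Integrand

/-! ### Local square integrability and weak divergence-freeness of the lift -/

section LiftProps

/-- **Local square integrability of the lift.** If `stLift u` is measurable on `(0,T) × ℝ^d` and
`u ∈ L²((0,T) × T^d)`, then `∫_{(0,T) × K} ‖u(t, proj y)‖² < ∞` for every compact `K ⊆ ℝ^d`:
Tonelli's inequality and the covering bound `∫_K H ∘ proj ≤ #window · ∫_{T^d} H` for the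
finitely many lattice translates of the unit cube meeting a ball containing `K`
(`Torus.setLIntegral_lift_le`). [folklore] -/
theorem lintegral_slab_lift_sq_lt_top {u : ℝ → UnitAddTorus d → EuclideanSpace ℝ d} {T : ℝ}
    (hmeas : AEStronglyMeasurable (Torus.stLift u) (volume.restrict (Ioo 0 T ×ˢ univ)))
    (hL2 : ∫⁻ t in Ioo 0 T, ∫⁻ x, ‖u t x‖ₑ ^ 2 < ∞) {K : Set (EuclideanSpace ℝ d)}
    (hK : IsCompact K) :
    ∫⁻ z in Ioo 0 T ×ˢ K, ‖uncurry (fun t => Torus.lift (u t)) z‖ₑ ^ 2 < ∞ := by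
  obtain ⟨r, hr⟩ := hK.isBounded.subset_closedBall 0
  obtain ⟨n, hn⟩ := exists_nat_ge (r + 1)
  have hU : AEStronglyMeasurable (uncurry u) ((volume.restrict (Ioo 0 T)).prod volume) := by
    have h := Torus.aestronglyMeasurable_uncurry_of_stLift_restrict hmeas
    rwa [Measure.volume_eq_prod, ← Measure.prod_restrict, Measure.restrict_univ] at h
  have hslice : ∀ᵐ t ∂(volume.restrict (Ioo 0 T)), AEStronglyMeasurable (u t) volume :=
    hU.prodMk_left
  have hvol : (volume : Measure (ℝ × EuclideanSpace ℝ d)).restrict (Ioo 0 T ×ˢ K) =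
      (volume.restrict (Ioo 0 T)).prod (volume.restrict K) := by
    rw [Measure.volume_eq_prod, Measure.prod_restrict]
  have hC : ((Torus.latticeWindow d n).card : ℝ≥0∞) ≠ ∞ := ENNReal.natCast_ne_top _
  rw [hvol]
  calc ∫⁻ z, ‖uncurry (fun t => Torus.lift (u t)) z‖ₑ ^ 2
        ∂(volume.restrict (Ioo 0 T)).prod (volume.restrict K)
      ≤ ∫⁻ t in Ioo 0 T, ∫⁻ y in K, ‖u t (Torus.proj y)‖ₑ ^ 2 := lintegral_prod_le _
    _ ≤ ∫⁻ t in Ioo 0 T, (Torus.latticeWindow d n).card * ∫⁻ x, ‖u t x‖ₑ ^ 2 := by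
        refine lintegral_mono_ae ?_
        filter_upwards [hslice] with t ht
        exact Torus.setLIntegral_lift_le (H := fun x => ‖u t x‖ₑ ^ 2)
          (ht.aemeasurable.enorm.pow_const 2) hr hn
    _ = (Torus.latticeWindow d n).card * ∫⁻ t in Ioo 0 T, ∫⁻ x, ‖u t x‖ₑ ^ 2 :=
        lintegral_const_mul' _ _ hC
    _ < ∞ := ENNReal.mul_lt_top (lt_top_iff_ne_top.2 hC) hL2

/-- **Weak divergence-freeness lifts.** If `v : T^d → ℝ^d` is weakly divergence free on the
torus then `v ∘ proj` is weakly divergence free on `ℝ^d`: for a test function `θ`, either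
`⟪v ∘ proj, ∇θ⟫` is not integrable (and the integral is `0` by the Bochner convention, the same
convention under which the torus predicate is stated), or
`∫_{ℝ^d} ⟪v ∘ proj, ∇θ⟫ = ∫_{T^d} ⟪v, ∇(periodize θ)⟫ = 0` by unfolding
(`Torus.integral_eq_integral_perSum_repr`, `Torus.gradient_periodize'`). [folklore] -/
theorem isWeaklyDivFree_lift {v : UnitAddTorus d → EuclideanSpace ℝ d}
    (hv : Torus.IsWeaklyDivFree v) : IsWeaklyDivFree (Torus.lift v) := by
  intro θ hθ
  by_cases hint : Integrable (fun y => ⟪Torus.lift v y, gradient θ y⟫) volume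
  swap
  · exact integral_undef hint
  obtain ⟨R, hR⟩ := hθ.hasCompactSupport.isCompact.isBounded.subset_closedBall 0
  have h1 : ContDiff ℝ 1 θ := hθ.contDiff.of_le (by exact_mod_cast le_top)
  have hsuppg : support (fun y => gradient θ y) ⊆ closedBall 0 R := by
    intro y hy
    refine (support_fderiv_subset ℝ).trans hR (mem_support.2 fun h => hy ?_)
    simp [gradient, h]
  have hsupp : support (fun y => ⟪Torus.lift v y, gradient θ y⟫) ⊆ closedBall 0 R :=
    fun y hy => hsuppg fun h => hy (by simp only [h, inner_zero_right])
  rw [Torus.integral_eq_integral_perSum_repr hint hsupp]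
  have hpt : ∀ x, Torus.perSum (fun y => ⟪Torus.lift v y, gradient θ y⟫) (Torus.repr x) =
      ⟪v x, Torus.gradient (Torus.periodize θ) x⟫ := fun x => by
    rw [Torus.gradient_periodize' h1 hR, Torus.perSum_inner_lift hsuppg, Torus.lift_apply,
      Torus.proj_repr]
  simp_rw [hpt]
  exact hv _ (Torus.isSmooth_periodize hθ.contDiff hR)

end LiftProps

/-! ### The corrected fact and its proof -/

namespace Torus

variable {T ν : ℝ} {f u : ℝ → UnitAddTorus d → EuclideanSpace ℝ d}
  {u₀ : UnitAddTorus d → EuclideanSpace ℝ d}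

/-- **Torus-to-space bridge for forced weak solutions (corrected statement of
`Torus.IsWeakNSSolutionForcedOn.lift`).** A forced weak solution with datum on the flat torus
`T^d × [0, T)` whose force has integrable slices `f t ∈ L¹(T^d)` for a.e. `t ∈ (0, T)` and whose
datum is integrable, `u₀ ∈ L¹(T^d)`, lifts to a (`ℤ^d`-periodic) weak solution on
`ℝ^d × [0, T)` in the sense of `Literature.Analysis.FluidPDE.IsWeakNSSolutionOn`, with data
`lift ∘ f`, `lift u₀`, `lift ∘ u` (Fefferman, (8), (10)–(11): the periodic problems are posed on
`ℝⁿ`; weak formulation of Leray 1934, §31, (5.15), where `u₀ ∈ L²` and there is no force).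
Discrepancy with the vendored `lift`: that statement has no hypothesis on `f`, `u₀`, which the
accepted torus predicate leaves completely free (they enter only through Bochner pairings with
junk value `0`), whereas every source assumes integrable data (Leray: `f = 0`, `u₀ ∈ L²`; Temam,
Ch. III §1.1: `f ∈ L²(0,T;V')`, `u₀ ∈ H`); the unfolding `∫_{ℝ^d} g = ∫_{T^d} ∑ₖ g(· + k)`
behind the bridge needs `g ∈ L¹`, i.e. exactly these two hypotheses for the force and datum
pairings. Proved below (`lift_of_integrable_holds`). [cite: Leray1934, §31 (5.15)] -/
def IsWeakNSSolutionForcedOn.lift_of_integrable : Prop :=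
  ∀ (_h : IsWeakNSSolutionForcedOn T ν f u₀ u)
    (_hf : ∀ᵐ t ∂(volume.restrict (Ioo 0 T)), Integrable (f t) volume)
    (_hu₀ : Integrable u₀ volume),
    FluidPDE.IsWeakNSSolutionOn (E := EuclideanSpace ℝ d) T ν
      (fun t => FunctionSpaces.Torus.lift (f t)) (FunctionSpaces.Torus.lift u₀)
      (fun t => FunctionSpaces.Torus.lift (u t))

/-- **Discharge of `Torus.IsWeakNSSolutionForcedOn.lift_of_integrable`.** Measurability is the
same statement (`uncurry (lift ∘ u) = stLift u`); local square integrability on `(0,T) × K` is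
`lintegral_slab_lift_sq_lt_top`; weak divergence-freeness of the slices is
`isWeaklyDivFree_lift`; and a divergence-free test field `ψ` on `(-∞, T) × ℝ^d` is paired with
the lifts exactly as its (smooth, periodic, divergence-free) periodisation
`Ψ t = ∑ₖ ψ(t, · + k)` is paired on `T^d`: for a.e. `t` the `ℝ^d` integrand is integrable
(`integrable_weakIntegrand_lift`, using `u t ∈ L²`, `f t ∈ L¹`), so
`∫_{ℝ^d} (…) = ∫_{T^d} ∑ₖ (…)(· + k) = ∫_{T^d} (torus integrand for Ψ)`
(`Torus.integral_eq_integral_perSum_repr`, `perSum_weakIntegrand_repr`), the time integrals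
agree (`integral_congr_ae`), the datum terms agree (`u₀ ∈ L¹`), and the torus identity for `Ψ`
is the claim (Leray 1934, §31, (5.15); Stein–Weiss, Ch. VII §2, Thm. 2.4 for the unfolding).
[cite: Leray1934, §31 (5.15)] -/
theorem IsWeakNSSolutionForcedOn.lift_of_integrable_holds :
    IsWeakNSSolutionForcedOn.lift_of_integrable (T := T) (ν := ν) (f := f) (u := u)
      (u₀ := u₀) := by
  intro h hf hu₀
  obtain ⟨hmeas, hL2, hdiv, hweak⟩ := h
  refine ⟨hmeas, fun K hK => lintegral_slab_lift_sq_lt_top hmeas hL2 hK, ?_, fun ψ hψ hψdiv => ?_⟩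
  · filter_upwards [hdiv] with t ht
    exact isWeaklyDivFree_lift ht
  obtain ⟨R, hR⟩ :=
    FunctionSpaces.Torus.exists_forall_tsupport_subset_closedBall hψ.hasCompactSupport
  have key := hweak (fun t => FunctionSpaces.Torus.periodize (ψ t)) hψ.isSpaceTimeTest_periodize
    (hψ.isDivFreeTest_periodize hψdiv)
  -- almost every slice `u t` is in `L²(T^d)`
  have hU : AEStronglyMeasurable (uncurry u) ((volume.restrict (Ioo 0 T)).prod volume) := by
    have h' := FunctionSpaces.Torus.aestronglyMeasurable_uncurry_of_stLift_restrict hmeas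
    rwa [Measure.volume_eq_prod, ← Measure.prod_restrict, Measure.restrict_univ] at h'
  have hslice : ∀ᵐ t ∂(volume.restrict (Ioo 0 T)), MemLp (u t) 2 volume := by
    have hm : ∀ᵐ t ∂(volume.restrict (Ioo 0 T)), AEStronglyMeasurable (u t) volume :=
      hU.prodMk_left
    have hint : AEMeasurable (fun t => ∫⁻ x, ‖u t x‖ₑ ^ 2) (volume.restrict (Ioo 0 T)) :=
      (hU.aemeasurable.enorm.pow_const 2).lintegral_prod_right'
    have hfin : ∀ᵐ t ∂(volume.restrict (Ioo 0 T)), ∫⁻ x, ‖u t x‖ₑ ^ 2 < ∞ :=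
      ae_lt_top' hint hL2.ne
    filter_upwards [hm, hfin] with t ht ht'
    refine ⟨ht, (eLpNorm_lt_top_iff_lintegral_rpow_enorm_lt_top two_ne_zero
      ENNReal.ofNat_ne_top).2 ?_⟩
    simpa only [ENNReal.toReal_ofNat, ENNReal.rpow_two] using ht'
  -- the space integrals agree for a.e. `t`, hence so do the time integrals
  have hinner : (∫ t in Ioo 0 T, ∫ y, (⟪FunctionSpaces.Torus.lift (u t) y, timeDeriv ψ t y⟫ +
      ⟪FunctionSpaces.Torus.lift (u t) y, convect (FunctionSpaces.Torus.lift (u t)) (ψ t) y⟫ +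
      ν * ⟪FunctionSpaces.Torus.lift (u t) y, Δ (ψ t) y⟫ +
      ⟪FunctionSpaces.Torus.lift (f t) y, ψ t y⟫)) =
      ∫ t in Ioo 0 T, ∫ x, (⟪u t x, FunctionSpaces.Torus.timeDeriv
        (fun s => FunctionSpaces.Torus.periodize (ψ s)) t x⟫ +
      ⟪u t x, FunctionSpaces.Torus.convect (u t) (FunctionSpaces.Torus.periodize (ψ t)) x⟫ +
      ν * ⟪u t x, FunctionSpaces.Torus.laplacian (FunctionSpaces.Torus.periodize (ψ t)) x⟫ +
      ⟪f t x, FunctionSpaces.Torus.periodize (ψ t) x⟫) := by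
    refine integral_congr_ae ?_
    filter_upwards [hslice, hf] with t ht hft
    rw [FunctionSpaces.Torus.integral_eq_integral_perSum_repr
      (integrable_weakIntegrand_lift hψ ht hft t)
      (support_weakIntegrand_subset hR (FunctionSpaces.Torus.lift (u t))
        (FunctionSpaces.Torus.lift (f t)) t)]
    exact integral_congr_ae (ae_of_all _ fun x => perSum_weakIntegrand_repr hψ hR t x)
  -- the datum terms agree
  have hdatum : ∫ y, ⟪FunctionSpaces.Torus.lift u₀ y, ψ 0 y⟫ =
      ∫ x, ⟪u₀ x, FunctionSpaces.Torus.periodize (ψ 0) x⟫ := by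
    have hs0 : support (ψ 0) ⊆ closedBall 0 R := (subset_tsupport _).trans (hR 0)
    have hint : Integrable (fun y => ⟪FunctionSpaces.Torus.lift u₀ y, ψ 0 y⟫) volume :=
      integrable_inner_of_support_subset_closedBall
        (FunctionSpaces.Torus.locallyIntegrable_lift hu₀) (hψ.contDiff_slice 0).continuous hs0
    have hsupp : support (fun y => ⟪FunctionSpaces.Torus.lift u₀ y, ψ 0 y⟫) ⊆ closedBall 0 R :=
      fun y hy => hs0 fun h0 => hy (by simp only [h0, inner_zero_right])
    rw [FunctionSpaces.Torus.integral_eq_integral_perSum_repr hint hsupp]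
    refine integral_congr_ae (ae_of_all _ fun x => ?_)
    dsimp only
    rw [perSum_inner_lift hs0, FunctionSpaces.Torus.lift_apply, FunctionSpaces.Torus.proj_repr,
      FunctionSpaces.Torus.periodize_apply]
  rw [hinner, hdatum]
  exact key

/-- **Deprecated name.** `Torus.IsWeakNSSolutionForcedOn.lift` was the named fact of
`Literature/Analysis/FluidPDE/WeakSolution.lean` asserting this torus-to-space bridge for
*arbitrary* force `f` and datum `u₀` — beyond every source (Leray 1934, §31, (5.15): `f = 0`,
`u₀ ∈ L²`; Temam, Ch. III §1.1: `f ∈ L²(0,T;V')`, `u₀ ∈ H`; Buckmaster–Vicol 2019, Def. 1.1: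
`f = 0`), the torus predicate leaving `f`, `u₀` completely free. It was retired there in the
2026-08-15 verdict clean-up and the name is kept as a deprecated alias of the corrected, proved
statement `lift_of_integrable` (same conclusion under `∀ᵐ t ∈ (0,T), f t ∈ L¹(T^d)` and
`u₀ ∈ L¹(T^d)`; proof `lift_of_integrable_holds`). [cite: Leray1934, §31 (5.15)] -/
@[deprecated IsWeakNSSolutionForcedOn.lift_of_integrable (since := "2026-08-15")]
alias IsWeakNSSolutionForcedOn.lift := IsWeakNSSolutionForcedOn.lift_of_integrable

end Torus

end Literature.Analysis.FluidPDE
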